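import Literature.Probability.LatticeModels.SixVertexGFF

/-!
# Six-vertex model: arrow-reversal symmetry, uniqueness of the planar slope-zero measure, and the
# odd-`k` case of the GFF convergence of the height function (DKLM 2026, §2)

H. Duminil-Copin, K. K. Kozlowski, P. Lammers, I. Manolescu, *Gaussian free field convergence of
the six-vertex model with `-1 ≤ Δ ≤ -1/2`*, arXiv:2603.06268 (2026) [DKLM2026SixVertexGFF], §2,
read in the held source (`paper:arxiv-2603.06268`), records next to Definition 2.4 and
Definition 2.6 the two elementary facts

> * `Φ_k ≡ Φ_k^{(δ)} ≡ 0` for `k` odd since `h` and `-h` have the same distribution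
>   (the weights `a₁ = a₂`, `b₁ = b₂`, `c₁ = c₂` "render `W(ω)` invariant under flipping all
>   orientations in `ω`", §2.1);
> * `Ψ_k^{GFF} ≡ 0` when `k` is odd since the set of pairings `π` is then empty;

and, after Theorem 2.2, that `ℙ_{ℤ²}` *is the unique probability measure* with
`lim_L lim_M ℙ_{𝕋_{M,L}}[A | balanced] = ℙ_{ℤ²}[A]` for all events `A` depending on finitely many
edges.

This file proves these statements for the objects of
`Literature/Probability/LatticeModels/SixVertexGFF.lean`, and deduces **mode (1) of Theorem 2.8
for odd `k`**: for every planar slope-zero six-vertex measure `P` (`IsPlanarSixVertexMeasure`)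
and every odd `k`, the scaled `k`-point functions `Φ_k^{(δ)}` and the limit `σ^k Ψ_k^{GFF}` both
vanish identically, so the uniform convergence asserted in
`DKLM2026_sixVertex_heightFunction_GFF` holds (on every set, for every `σ`). The even-`k` case and
mode (2) are the actual content of the paper (spectral representation, RSW theory, rotational
invariance, Bethe ansatz) and are NOT proved here.

## Contents

* `fpfInvolutions_eq_empty_of_odd`, `gffKPoint_of_odd` — no pairings of an odd set.
* Arrow reversal `ω ↦ (fun w => (!(ω w).1, !(ω w).2))` (written inline, no new definition):
  `vertexWeight_flip`, `torusWeight_flip`, `isBalanced_flip_iff`, `torusCondProb_flip_preimage`,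
  `torusCondProbNat_flip_preimage`, `heightAt_flip`, `heightPlane_flip`, `measurable_flip`.
* Window events: `measurable_planeWindow`, `measurableSet_window`, `window_mono`
  (a smaller window event is a larger window event), `eval_preimage_eq_window`,
  `generateFrom_window`, `isPiSystem_window`.
* `IsPlanarSixVertexMeasure.measure_window_eq`, `IsPlanarSixVertexMeasure.unique`,
  `IsPlanarSixVertexMeasure.map_flip`, `IsPlanarSixVertexMeasure.map_flip_eq`,
  `IsPlanarSixVertexMeasure.integral_flip_eq`.
* `kPoint_eq_zero_of_odd`, `kPointScaled_eq_zero_of_odd`,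
  `tendstoUniformlyOn_kPointScaled_of_odd`, `DKLM2026_mode1_of_odd`.

## References

* H. Duminil-Copin, K. K. Kozlowski, P. Lammers, I. Manolescu, arXiv:2603.06268 (2026), §2.1,
  Def. 2.4 (remarks), Def. 2.6 (1) (remark), Thm. 2.2 (uniqueness clause). [DKLM2026SixVertexGFF]
-/

noncomputable section

open MeasureTheory Filter Topology ProbabilityTheory
open scoped NNReal BoundedContinuousFunction

namespace Literature.Probability.LatticeModels.SixVertex

/-! ### No pairings of an odd set -/

/-- A fixed-point-free involution of `Fin k` pairs up the elements, so `k` is even: for odd `k`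
the finset `fpfInvolutions k` of Def. 2.6 is empty ("`π` is then empty").
[cite: DKLM2026SixVertexGFF, Def. 2.6] -/
theorem fpfInvolutions_eq_empty_of_odd {k : ℕ} (hk : Odd k) : fpfInvolutions k = ∅ := by
  rw [fpfInvolutions, Finset.filter_eq_empty_iff]
  rintro σ - ⟨hσ, hfix⟩
  have hsupp : σ.support = Finset.univ := by
    ext i
    simp only [Equiv.Perm.mem_support, ne_eq, Finset.mem_univ, iff_true]
    exact hfix i
  have h2 : 2 ∣ σ.support.card := Equiv.Perm.two_dvd_card_support (by rw [sq]; exact hσ)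
  rw [hsupp, Finset.card_univ, Fintype.card_fin] at h2
  exact (Nat.not_even_iff_odd.2 hk) (even_iff_two_dvd.2 h2)

/-- `Ψ_k^{GFF} ≡ 0` for odd `k` (Def. 2.6 (1): the sum over pairings is empty).
[cite: DKLM2026SixVertexGFF, Def. 2.6] -/
theorem gffKPoint_of_odd {k : ℕ} (hk : Odd k) (u : Fin k → ℂ × ℂ) : gffKPoint k u = 0 := by
  simp [gffKPoint, fpfInvolutions_eq_empty_of_odd hk]

/-! ### Arrow reversal: local weights, torus weights, balancedness -/

/-- Reversing every arrow preserves each local Boltzmann weight when `a₁ = a₂`, `b₁ = b₂`,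
`c₁ = c₂` (§2.1: the symmetric weights "render `W(ω)` invariant under flipping all orientations").
[cite: DKLM2026SixVertexGFF, §2.1] -/
theorem vertexWeight_flip {G₁ G₂ : Type*} [AddGroup G₁] [AddGroup G₂] [One G₁] [One G₂]
    (a b c : ℝ) (ω : Config (G₁ × G₂)) (v : G₁ × G₂) :
    vertexWeight a b c (fun w => (!(ω w).1, !(ω w).2)) v = vertexWeight a b c ω v := by
  obtain ⟨b₁, h₁⟩ : ∃ β : Bool, (ω v).1 = β := ⟨_, rfl⟩
  obtain ⟨b₂, h₂⟩ : ∃ β : Bool, (ω v).2 = β := ⟨_, rfl⟩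
  obtain ⟨b₃, h₃⟩ : ∃ β : Bool, (ω (v.1 - 1, v.2)).1 = β := ⟨_, rfl⟩
  obtain ⟨b₄, h₄⟩ : ∃ β : Bool, (ω (v.1, v.2 - 1)).2 = β := ⟨_, rfl⟩
  cases b₁ <;> cases b₂ <;> cases b₃ <;> cases b₄ <;> simp [vertexWeight, inDegree, h₁, h₂, h₃, h₄]

/-- The torus weight `W(ω)` is invariant under reversing all arrows. [cite: DKLM2026SixVertexGFF, §2.1] -/
theorem torusWeight_flip {G₁ G₂ : Type*} [AddGroup G₁] [AddGroup G₂] [One G₁] [One G₂]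
    [Fintype G₁] [Fintype G₂] (a b c : ℝ) (ω : Config (G₁ × G₂)) :
    torusWeight a b c (fun w => (!(ω w).1, !(ω w).2)) = torusWeight a b c ω := by
  unfold torusWeight
  exact Finset.prod_congr rfl fun v _ => vertexWeight_flip a b c ω v

/-- Reversing all arrows maps balanced configurations to balanced configurations (each column has
as many east as west arrows). [cite: DKLM2026SixVertexGFF, §2.1] -/
theorem isBalanced_flip_iff {G₁ G₂ : Type*} [Fintype G₂] (ω : Config (G₁ × G₂)) :
    IsBalanced (fun w => (!(ω w).1, !(ω w).2)) ↔ IsBalanced ω := by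
  unfold IsBalanced
  refine forall_congr' fun x => ?_
  simp only [Finset.card_filter]
  have h : ∑ y : G₂, ((if (!(ω (x, y)).1) = true then 1 else 0) +
      (if (ω (x, y)).1 = true then 1 else 0)) = Fintype.card G₂ := by
    rw [← Finset.card_univ, Finset.card_eq_sum_ones]
    refine Finset.sum_congr rfl fun y _ => ?_
    obtain ⟨β, hβ⟩ : ∃ β : Bool, (ω (x, y)).1 = β := ⟨_, rfl⟩
    cases β <;> simp [hβ]
  rw [Finset.sum_add_distrib] at h
  omega

/-- `ℙ_{𝕋}[flip⁻¹ A | balanced] = ℙ_{𝕋}[A | balanced]`: the conditioned torus measure is invariant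
under arrow reversal. [cite: DKLM2026SixVertexGFF, §2.1] -/
theorem torusCondProb_flip_preimage {G₁ G₂ : Type*} [AddGroup G₁] [AddGroup G₂] [One G₁] [One G₂]
    [Fintype G₁] [Fintype G₂] [DecidableEq G₁] [DecidableEq G₂]
    (a b c : ℝ) (A : Set (Config (G₁ × G₂))) :
    torusCondProb a b c {ω | (fun w => (!(ω w).1, !(ω w).2)) ∈ A} = torusCondProb a b c A := by
  classical
  have hinv : Function.Involutive
      (fun (ω : Config (G₁ × G₂)) (w : G₁ × G₂) => (!(ω w).1, !(ω w).2)) := by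
    intro ω
    funext w
    simp
  let Φ : Config (G₁ × G₂) ≃ Config (G₁ × G₂) :=
    ⟨fun ω w => (!(ω w).1, !(ω w).2), fun ω w => (!(ω w).1, !(ω w).2),
      hinv.leftInverse, hinv.rightInverse⟩
  unfold torusCondProb
  simp only [Finset.sum_filter]
  congr 1
  rw [← Equiv.sum_comp Φ (fun ω => if IsBalanced ω ∧ ω ∈ A then torusWeight a b c ω else 0)]
  refine Finset.sum_congr rfl fun ω _ => ?_
  have hΦω : (Φ ω : Config (G₁ × G₂)) = fun w => (!(ω w).1, !(ω w).2) := rfl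
  have hiff : (IsBalanced ω ∧ ω ∈ {ω : Config (G₁ × G₂) | (fun w => (!(ω w).1, !(ω w).2)) ∈ A}) ↔
      (IsBalanced (Φ ω) ∧ (Φ ω) ∈ A) := by
    rw [hΦω, isBalanced_flip_iff]
    rfl
  by_cases h : IsBalanced ω ∧ ω ∈ {ω : Config (G₁ × G₂) | (fun w => (!(ω w).1, !(ω w).2)) ∈ A}
  · rw [if_pos h, if_pos (hiff.mp h), hΦω, torusWeight_flip]
  · rw [if_neg h, if_neg (fun h' => h (hiff.mpr h'))]

/-! ### Arrow reversal and window events -/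

/-- `ℙ_{𝕋_{M,L}}[window ∈ flip⁻¹ S | balanced] = ℙ_{𝕋_{M,L}}[window ∈ S | balanced]`.
[cite: DKLM2026SixVertexGFF, §2.1] -/
theorem torusCondProbNat_flip_preimage (a b c : ℝ) (M L n : ℕ)
    (S : Set (Config (Fin (2 * n + 1) × Fin (2 * n + 1)))) :
    torusCondProbNat a b c M L n {w | (fun p => (!(w p).1, !(w p).2)) ∈ S} =
      torusCondProbNat a b c M L n S := by
  unfold torusCondProbNat
  split_ifs with hM hL
  · rfl
  · rfl
  · haveI : NeZero M := ⟨hM⟩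
    haveI : NeZero L := ⟨hL⟩
    exact torusCondProb_flip_preimage (G₁ := ZMod M) (G₂ := ZMod L) a b c
      {ω : Config (ZMod M × ZMod L) | torusWindow n ω ∈ S}

/-- The window map `planeWindow n` is measurable (product σ-algebras). [folklore] -/
theorem measurable_planeWindow (n : ℕ) : Measurable (planeWindow n) :=
  measurable_pi_lambda _ fun _ => measurable_pi_apply _

/-- Window events are measurable. [folklore] -/
theorem measurableSet_window (n : ℕ) (S : Set (Config (Fin (2 * n + 1) × Fin (2 * n + 1)))) :
    MeasurableSet {ω : Config (ℤ × ℤ) | planeWindow n ω ∈ S} :=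
  measurable_planeWindow n S.toFinite.measurableSet

/-- Arrow reversal on `ℤ²` is measurable. [folklore] -/
theorem measurable_flip :
    Measurable (fun (ω : Config (ℤ × ℤ)) (w : ℤ × ℤ) => (!(ω w).1, !(ω w).2)) :=
  measurable_pi_lambda _ fun w =>
    (measurable_of_countable fun b : Bool × Bool => (!b.1, !b.2)).comp (measurable_pi_apply w)

/-- A window event of size `m` is a window event of every size `n ≥ m`. [folklore] -/
theorem window_mono {m n : ℕ} (hmn : m ≤ n)
    (S : Set (Config (Fin (2 * m + 1) × Fin (2 * m + 1)))) :
    ∃ T : Set (Config (Fin (2 * n + 1) × Fin (2 * n + 1))),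
      {ω : Config (ℤ × ℤ) | planeWindow m ω ∈ S} = {ω | planeWindow n ω ∈ T} := by
  refine ⟨{w | (fun p : Fin (2 * m + 1) × Fin (2 * m + 1) =>
    w (⟨p.1 + (n - m), by omega⟩, ⟨p.2 + (n - m), by omega⟩)) ∈ S}, ?_⟩
  ext ω
  simp only [Set.mem_setOf_eq]
  suffices h : (fun p : Fin (2 * m + 1) × Fin (2 * m + 1) =>
      planeWindow n ω (⟨p.1 + (n - m), by omega⟩, ⟨p.2 + (n - m), by omega⟩)) = planeWindow m ω by
    rw [h]
  funext p
  simp only [planeWindow]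
  congr 2 <;> push_cast [Nat.cast_sub hmn] <;> ring

/-- A coordinate event `{ω | ω v ∈ T}` is a window event (window size `|v₁| + |v₂|`). [folklore] -/
theorem eval_preimage_eq_window (v : ℤ × ℤ) (T : Set (Bool × Bool)) :
    ∃ (n : ℕ) (S : Set (Config (Fin (2 * n + 1) × Fin (2 * n + 1)))),
      {ω : Config (ℤ × ℤ) | ω v ∈ T} = {ω | planeWindow n ω ∈ S} := by
  set n : ℕ := v.1.natAbs + v.2.natAbs with hn
  have h1 : (v.1 + n).toNat < 2 * n + 1 := by omega
  have h2 : (v.2 + n).toNat < 2 * n + 1 := by omega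
  refine ⟨n, {w | w (⟨(v.1 + n).toNat, h1⟩, ⟨(v.2 + n).toNat, h2⟩) ∈ T}, ?_⟩
  ext ω
  simp only [Set.mem_setOf_eq, planeWindow]
  have e1 : (((v.1 + n).toNat : ℕ) : ℤ) - n = v.1 := by omega
  have e2 : (((v.2 + n).toNat : ℕ) : ℤ) - n = v.2 := by omega
  rw [e1, e2]

/-- **Window events generate the product σ-algebra** on planar arrow configurations. [folklore] -/
theorem generateFrom_window :
    MeasurableSpace.generateFrom {A : Set (Config (ℤ × ℤ)) |
        ∃ (n : ℕ) (S : Set (Config (Fin (2 * n + 1) × Fin (2 * n + 1)))),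
          A = {ω | planeWindow n ω ∈ S}} =
      (inferInstance : MeasurableSpace (Config (ℤ × ℤ))) := by
  refine le_antisymm (MeasurableSpace.generateFrom_le ?_) ?_
  · rintro A ⟨n, S, rfl⟩
    exact measurableSet_window n S
  · have hpi : (inferInstance : MeasurableSpace (Config (ℤ × ℤ))) =
        MeasurableSpace.generateFrom {B : Set (ℤ × ℤ → Bool × Bool) |
          ∃ (i : ℤ × ℤ) (A : Set (Bool × Bool)), MeasurableSet A ∧ Function.eval i ⁻¹' A = B} :=
      MeasurableSpace.pi_eq_generateFrom_projections (α := fun _ : ℤ × ℤ => Bool × Bool)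
    rw [hpi]
    refine MeasurableSpace.generateFrom_le fun B hB => ?_
    obtain ⟨i, A, -, rfl⟩ := hB
    obtain ⟨n, S, hS⟩ := eval_preimage_eq_window i A
    refine MeasurableSpace.measurableSet_generateFrom ⟨n, S, ?_⟩
    rw [← hS]
    rfl

/-- Window events form a π-system. [folklore] -/
theorem isPiSystem_window :
    IsPiSystem {A : Set (Config (ℤ × ℤ)) |
        ∃ (n : ℕ) (S : Set (Config (Fin (2 * n + 1) × Fin (2 * n + 1)))),
          A = {ω | planeWindow n ω ∈ S}} := by
  rintro A ⟨n₁, S₁, rfl⟩ B ⟨n₂, S₂, rfl⟩ -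
  obtain ⟨T₁, hT₁⟩ := window_mono (le_max_left n₁ n₂) S₁
  obtain ⟨T₂, hT₂⟩ := window_mono (le_max_right n₁ n₂) S₂
  refine ⟨max n₁ n₂, T₁ ∩ T₂, ?_⟩
  rw [hT₁, hT₂]
  rfl

/-! ### Uniqueness and arrow-reversal invariance of the planar slope-zero measure -/

/-- Two planar slope-zero six-vertex measures (for the same weights) give every window event the
same mass: both are the iterated limit `lim_ℓ lim_M ℙ_{𝕋_{M,2ℓ}}[· | balanced]`.
[cite: DKLM2026SixVertexGFF, Thm. 2.2] -/
theorem IsPlanarSixVertexMeasure.measure_window_eq {a b c : ℝ} {P P' : Measure (Config (ℤ × ℤ))}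
    (hP : IsPlanarSixVertexMeasure a b c P) (hP' : IsPlanarSixVertexMeasure a b c P') (n : ℕ)
    (S : Set (Config (Fin (2 * n + 1) × Fin (2 * n + 1)))) :
    P {ω | planeWindow n ω ∈ S} = P' {ω | planeWindow n ω ∈ S} := by
  haveI := hP.1
  haveI := hP'.1
  obtain ⟨q, hq, hqP⟩ := hP.2 n S
  obtain ⟨q', hq', hqP'⟩ := hP'.2 n S
  have hqq : q = q' := funext fun ℓ => tendsto_nhds_unique (hq ℓ) (hq' ℓ)
  subst hqq
  have h := tendsto_nhds_unique hqP hqP'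
  exact (ENNReal.toReal_eq_toReal_iff' (measure_ne_top _ _) (measure_ne_top _ _)).mp h

/-- **Uniqueness of the planar slope-zero six-vertex measure** ("`ℙ_{ℤ²}` is the unique
probability measure such that `lim_L lim_M ℙ_{𝕋_{M,L}}[A | balanced] = ℙ_{ℤ²}[A]` for every event
`A` depending on finitely many edges"): window events form a π-system generating the σ-algebra.
[cite: DKLM2026SixVertexGFF, Thm. 2.2] -/
theorem IsPlanarSixVertexMeasure.unique {a b c : ℝ} {P P' : Measure (Config (ℤ × ℤ))}
    (hP : IsPlanarSixVertexMeasure a b c P) (hP' : IsPlanarSixVertexMeasure a b c P') : P = P' := by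
  haveI := hP.1
  haveI := hP'.1
  refine ext_of_generate_finite _ generateFrom_window.symm isPiSystem_window ?_ (by simp)
  rintro A ⟨n, S, rfl⟩
  exact hP.measure_window_eq hP' n S

/-- The image of a planar slope-zero measure under arrow reversal is again a planar slope-zero
measure for the same weights (the torus conditional probabilities are reversal invariant).
[cite: DKLM2026SixVertexGFF, §2.1 and Thm. 2.2] -/
theorem IsPlanarSixVertexMeasure.map_flip {a b c : ℝ} {P : Measure (Config (ℤ × ℤ))}
    (hP : IsPlanarSixVertexMeasure a b c P) :
    IsPlanarSixVertexMeasure a b c (P.map fun (ω : Config (ℤ × ℤ)) (w : ℤ × ℤ) => (!(ω w).1, !(ω w).2)) := by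
  haveI := hP.1
  refine ⟨Measure.isProbabilityMeasure_map measurable_flip.aemeasurable, fun n S => ?_⟩
  obtain ⟨q, hq, hqP⟩ := hP.2 n {w | (fun p => (!(w p).1, !(w p).2)) ∈ S}
  refine ⟨q, fun ℓ => ?_, ?_⟩
  · simpa only [torusCondProbNat_flip_preimage] using hq ℓ
  · rw [Measure.map_apply measurable_flip (measurableSet_window n S)]
    exact hqP

/-- **`ℙ_{ℤ²}` is invariant under reversing all arrows** (hence `h` and `-h` have the same law).
[cite: DKLM2026SixVertexGFF, §2.1 and Def. 2.4] -/
theorem IsPlanarSixVertexMeasure.map_flip_eq {a b c : ℝ} {P : Measure (Config (ℤ × ℤ))}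
    (hP : IsPlanarSixVertexMeasure a b c P) :
    P.map (fun (ω : Config (ℤ × ℤ)) (w : ℤ × ℤ) => (!(ω w).1, !(ω w).2)) = P :=
  hP.map_flip.unique hP

/-- Change of variables under arrow reversal: `𝔼_{ℤ²}[F(flip ω)] = 𝔼_{ℤ²}[F(ω)]` for every `F`.
[cite: DKLM2026SixVertexGFF, §2.1 and Def. 2.4] -/
theorem IsPlanarSixVertexMeasure.integral_flip_eq {a b c : ℝ} {P : Measure (Config (ℤ × ℤ))}
    (hP : IsPlanarSixVertexMeasure a b c P) (F : Config (ℤ × ℤ) → ℝ) :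
    ∫ ω, F (fun w => (!(ω w).1, !(ω w).2)) ∂P = ∫ ω, F ω ∂P := by
  have hinv : Function.Involutive
      (fun (ω : Config (ℤ × ℤ)) (w : ℤ × ℤ) => (!(ω w).1, !(ω w).2)) := by
    intro ω
    funext w
    simp
  let e : Config (ℤ × ℤ) ≃ᵐ Config (ℤ × ℤ) :=
    { toFun := fun ω w => (!(ω w).1, !(ω w).2)
      invFun := fun ω w => (!(ω w).1, !(ω w).2)
      left_inv := hinv.leftInverse
      right_inv := hinv.rightInverse
      measurable_toFun := measurable_flip
      measurable_invFun := measurable_flip }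
  have hmap : P.map e = P := hP.map_flip_eq
  calc ∫ ω, F (fun w => (!(ω w).1, !(ω w).2)) ∂P = ∫ ω, F (e ω) ∂P := rfl
    _ = ∫ ω, F ω ∂(P.map e) := (integral_map_equiv e F).symm
    _ = ∫ ω, F ω ∂P := by rw [hmap]

/-! ### Arrow reversal negates the height function -/

/-- Reversing all arrows negates every eastward height increment. [cite: DKLM2026SixVertexGFF, Def. 2.3] -/
theorem eastStep_flip (ω : Config (ℤ × ℤ)) (x y : ℤ) :
    eastStep (fun w => (!(ω w).1, !(ω w).2)) x y = -eastStep ω x y := by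
  obtain ⟨β, hβ⟩ : ∃ β : Bool, (ω (x + 1, y)).2 = β := ⟨_, rfl⟩
  cases β <;> simp [eastStep, hβ]

/-- Reversing all arrows negates every northward height increment. [cite: DKLM2026SixVertexGFF, Def. 2.3] -/
theorem northStep_flip (ω : Config (ℤ × ℤ)) (x y : ℤ) :
    northStep (fun w => (!(ω w).1, !(ω w).2)) x y = -northStep ω x y := by
  obtain ⟨β, hβ⟩ : ∃ β : Bool, (ω (x, y + 1)).1 = β := ⟨_, rfl⟩
  cases β <;> simp [northStep, hβ]

/-- The signed interval sum is odd under negating the summand. [folklore] -/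
theorem zsumIco_neg (f : ℤ → ℤ) (a b : ℤ) : zsumIco (fun k => -f k) a b = -zsumIco f a b := by
  unfold zsumIco
  split_ifs <;> simp [Finset.sum_neg_distrib]

/-- Reversing all arrows negates the height function: `h_{flip ω} = -h_ω` (with `h(0,0) = 0`).
[cite: DKLM2026SixVertexGFF, Def. 2.3 and Def. 2.4] -/
theorem heightAt_flip (ω : Config (ℤ × ℤ)) (f : ℤ × ℤ) :
    heightAt (fun w => (!(ω w).1, !(ω w).2)) f = -heightAt ω f := by
  unfold heightAt
  have h1 : (fun x => eastStep (fun w => (!(ω w).1, !(ω w).2)) x 0) = fun x => -eastStep ω x 0 :=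
    funext fun x => eastStep_flip ω x 0
  have h2 : (fun y => northStep (fun w => (!(ω w).1, !(ω w).2)) f.1 y) =
      fun y => -northStep ω f.1 y :=
    funext fun y => northStep_flip ω f.1 y
  rw [h1, h2, zsumIco_neg, zsumIco_neg]
  ring

/-- Reversing all arrows negates the piecewise-constant height function on the plane.
[cite: DKLM2026SixVertexGFF, §2.2] -/
theorem heightPlane_flip (ω : Config (ℤ × ℤ)) (z : ℂ) :
    heightPlane (fun w => (!(ω w).1, !(ω w).2)) z = -heightPlane ω z :=
  heightAt_flip ω _

/-! ### `Φ_k ≡ 0` for odd `k`, and mode (1) of Theorem 2.8 for odd `k` -/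

/-- **`Φ_k ≡ 0` for `k` odd** "since `h` and `-h` have the same distribution" (remark after
Def. 2.4), for every planar slope-zero six-vertex measure. [cite: DKLM2026SixVertexGFF, Def. 2.4] -/
theorem kPoint_eq_zero_of_odd {a b c : ℝ} {P : Measure (Config (ℤ × ℤ))}
    (hP : IsPlanarSixVertexMeasure a b c P) {k : ℕ} (hk : Odd k) (u : Fin k → ℂ × ℂ) :
    kPoint P k u = 0 := by
  have key := hP.integral_flip_eq
    (fun ω => ∏ i, ((heightPlane ω (u i).2 : ℝ) - (heightPlane ω (u i).1 : ℝ)))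
  have hneg : ∀ ω : Config (ℤ × ℤ),
      (∏ i, ((heightPlane (fun w => (!(ω w).1, !(ω w).2)) (u i).2 : ℝ) -
        (heightPlane (fun w => (!(ω w).1, !(ω w).2)) (u i).1 : ℝ))) =
      -∏ i, ((heightPlane ω (u i).2 : ℝ) - (heightPlane ω (u i).1 : ℝ)) := by
    intro ω
    have hfac : ∀ i : Fin k,
        ((heightPlane (fun w => (!(ω w).1, !(ω w).2)) (u i).2 : ℝ) -
          (heightPlane (fun w => (!(ω w).1, !(ω w).2)) (u i).1 : ℝ)) =
        -((heightPlane ω (u i).2 : ℝ) - (heightPlane ω (u i).1 : ℝ)) := by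
      intro i
      rw [heightPlane_flip, heightPlane_flip]
      push_cast
      ring
    rw [Finset.prod_congr rfl fun i _ => hfac i, Finset.prod_neg, Finset.card_univ,
      Fintype.card_fin, hk.neg_one_pow, neg_one_mul]
  simp only [hneg, integral_neg] at key
  unfold kPoint
  linarith

/-- The scaled `k`-point functions vanish for odd `k`. [cite: DKLM2026SixVertexGFF, Def. 2.4] -/
theorem kPointScaled_eq_zero_of_odd {a b c : ℝ} {P : Measure (Config (ℤ × ℤ))}
    (hP : IsPlanarSixVertexMeasure a b c P) {k : ℕ} (hk : Odd k) (δ : ℝ) (u : Fin k → ℂ × ℂ) :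
    kPointScaled P k δ u = 0 :=
  kPoint_eq_zero_of_odd hP hk _

/-- For odd `k` both `Φ_k^{(δ)}` and `σ^k Ψ_k^{GFF}` vanish identically, so `Φ_k^{(δ)} → σ^k Ψ_k^{GFF}`
uniformly on every set as `δ → 0⁺`, for every `σ`. [cite: DKLM2026SixVertexGFF, Def. 2.4, Def. 2.6 and Def. 2.7 (1)] -/
theorem tendstoUniformlyOn_kPointScaled_of_odd {a b c : ℝ} {P : Measure (Config (ℤ × ℤ))}
    (hP : IsPlanarSixVertexMeasure a b c P) {k : ℕ} (hk : Odd k) (s : ℝ)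
    (K : Set (Fin k → ℂ × ℂ)) :
    TendstoUniformlyOn (fun δ u => kPointScaled P k δ u) (fun u => s ^ k * gffKPoint k u)
      (𝓝[>] (0 : ℝ)) K := by
  have h1 : (fun δ u => kPointScaled P k δ u) = fun (_ : ℝ) (_ : Fin k → ℂ × ℂ) => (0 : ℝ) := by
    funext δ u
    exact kPointScaled_eq_zero_of_odd hP hk δ u
  have h2 : (fun u => s ^ k * gffKPoint k u) = fun (_ : Fin k → ℂ × ℂ) => (0 : ℝ) := by
    funext u
    rw [gffKPoint_of_odd hk, mul_zero]
  rw [h1, h2]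
  exact (tendsto_const_nhds (x := (0 : ℝ))).tendstoUniformlyOn_const K

/-- **Theorem 2.8, mode (1), odd `k`** — the part of `DKLM2026_sixVertex_heightFunction_GFF` that
follows from the arrow-reversal symmetry alone: for `√3 ≤ c ≤ 2` (indeed for any weights), every
planar slope-zero six-vertex measure `P` and every odd `k`, `Φ_k^{(δ)} → σ^k Ψ_k^{GFF}` uniformly
on every `K` (in particular on compact subsets of `𝒟_k`) as `δ → 0⁺`, with `σ = dklmSigma c`.
The even-`k` case is the content of the paper and is not proved here.
[cite: DKLM2026SixVertexGFF, Thm. 2.8 with Def. 2.7 (1), odd k] -/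
theorem DKLM2026_mode1_of_odd (c : ℝ) (P : Measure (Config (ℤ × ℤ)))
    (hP : IsPlanarSixVertexMeasure 1 1 c P) (k : ℕ) (hk : Odd k) (K : Set (Fin k → ℂ × ℂ)) :
    TendstoUniformlyOn (fun δ u => kPointScaled P k δ u)
      (fun u => dklmSigma c ^ k * gffKPoint k u) (𝓝[>] (0 : ℝ)) K :=
  tendstoUniformlyOn_kPointScaled_of_odd hP hk _ K

end Literature.Probability.LatticeModels.SixVertex

end
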